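import Summits.AtomisticToContinuum.FouriersLaw.Theorems.EmbeddedDrudeMourreAbelThermodynamicLimitAnchoredKuboPairCorrelations
import Summits.AtomisticToContinuum.FouriersLaw.Theorems.LatticeLandauDampingAbelThermodynamicLimitFixedFrequencyMatchingAutocorrBound
import HarnessLib

/-!
# `stub_autocorrIntegrableOn` of line `SketchIdeator2`: fixed-`N` integrability on `(0,∞)` of the
open chain's total-current autocorrelation
(crux `LatticeLandauDamping.AbelThermodynamicLimit`, item stmt-AtomisticToContinuum-14013, `Iff.rfl`-identical
to `EmbeddedDrudeMourre.AbelThermodynamicLimit`, stmt-AtomisticToContinuum-12596; `--supports` helper file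
proving the registered stub `stub_autocorrIntegrableOn` — the fixed-`N` conjunct of birth stub 2
`stub_uniformL1Tail` of stmt-AtomisticToContinuum-13416 — and closing nothing)

For the OPEN pinned anharmonic chain `P = pinnedChain ω₂ lam β γ` (all parameters `> 0`) with both
Langevin baths at temperature `T > 0`, the equilibrium autocorrelation of the TOTAL bond current
`J = Σ_i j_i`,

  `c_N(t) = ∫ J · (P_t J) dμ_{N,T}`

(Gibbs measure `gibbsMeasure N T`, constructed kernels `transitionKernel N T T t` of
Cuneo–Eckmann–Hairer–Rey-Bellet 2018), is integrable on `(0, ∞)` for EVERY fixed `N`.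

Proof. For `N ≥ 1` this is `pinnedChain_integrableOn_crossCorr` (exponential convergence to
equilibrium, CEHR 2018 Thm 2.13 (3), with an `N`-dependent rate — harmless at fixed `N`) applied to
`f = g = J`: `J` is continuous (`continuous_totalBondCurrent`), of exponential class `|J| ≤ M e^{H/(4T)}`
(`abs_totalBondCurrent_le_exp` at the admissible exponent `ϑ = 1/(4T)` of `quarter_inv_temp_admissible`)
and centred, `μ_{N,T}(J) = 0` (`integral_totalBondCurrent_gibbsMeasure`, momentum reversal).
For `N = 0` the sum over `Fin 0` is empty, so `c_0 ≡ 0` is integrable.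

References: Cuneo–Eckmann–Hairer–Rey-Bellet 2018, Thm 2.13 (3); Bonetto–Lebowitz–Rey-Bellet 2000 §7.
No named fact is used; nothing here closes the item.
-/

noncomputable section

open MeasureTheory ProbabilityTheory Filter Topology Set Function
open scoped NNReal ENNReal

namespace Summit.AtomisticToContinuum.FouriersLaw.Theorems.AbelThermodynamicLimit.SeriesLawAtEveryLaplaceFrequency

open Literature.MathematicalPhysics.KineticTheory.HeatConduction
open Literature.MathematicalPhysics.KineticTheory OscillatorChain
open Summit.AtomisticToContinuum.FouriersLaw.Theorems.LightConeBondHeat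
open Summit.AtomisticToContinuum.FouriersLaw.Theorems.AbelThermodynamicLimit.LoomisCompactHorizonWitness

/-- **Fixed-`N` integrability of the total-current autocorrelation (`N ≥ 1`).** For
`P = pinnedChain ω₂ lam β γ` (`ω₂, β, γ > 0`, `lam ≥ 0`), `T > 0` and `0 < N`, the function
`t ↦ c_N(t) = ∫ J · (P_{t⁺} J) dμ_{N,T}` (`J = Σ_i j_i`) is integrable on `(0, ∞)`:
`pinnedChain_integrableOn_crossCorr` with `f = g = J` at the exponent `ϑ = 1/(4T)`. [folklore] -/
theorem pinnedChain_integrableOn_totalCurrentAutocorr {ω₂ lam β γ : ℝ} (hω : 0 < ω₂) (hl : 0 ≤ lam)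
    (hβ : 0 < β) (hγ : 0 < γ) {N : ℕ} (hN : 0 < N) {T : ℝ} (hT : 0 < T) :
    IntegrableOn (fun t : ℝ => ∫ z, (∑ i : Fin N, (pinnedChain ω₂ lam β γ).bondCurrent N i z) *
        (∫ y, (∑ i : Fin N, (pinnedChain ω₂ lam β γ).bondCurrent N i y)
          ∂((pinnedChain ω₂ lam β γ).transitionKernel N T T t.toNNReal z))
      ∂((pinnedChain ω₂ lam β γ).gibbsMeasure N T)) (Ioi 0) := by
  obtain ⟨hϑ0, h2ϑ⟩ := quarter_inv_temp_admissible hT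
  obtain ⟨M, -, hM⟩ :=
    OddSectorIrreversibility.Corrector.abs_totalBondCurrent_le_exp hω.le hl hβ.le γ N hϑ0
  exact pinnedChain_integrableOn_crossCorr hω hl hβ hγ hN hT hϑ0 h2ϑ
    (OddSectorIrreversibility.Corrector.continuous_totalBondCurrent ω₂ lam β γ N) hM
    (OddSectorIrreversibility.Corrector.continuous_totalBondCurrent ω₂ lam β γ N) hM
    (OddSectorIrreversibility.Corrector.integral_totalBondCurrent_gibbsMeasure ω₂ lam β γ N T)

/-- **Registered stub `stub_autocorrIntegrableOn` of line `SketchIdeator2`** (fixed-`N` conjunct of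
birth stub 2 `stub_uniformL1Tail` of stmt-AtomisticToContinuum-13416): for `pinnedChain ω₂ lam β γ`
(all `> 0`), `T > 0` and EVERY `N`, `t ↦ c_N(t) = ∫ J · (P_t J) dμ_{N,T}` is integrable on `(0, ∞)`
(`N ≥ 1`: `pinnedChain_integrableOn_totalCurrentAutocorr`; `N = 0`: `c_0 ≡ 0`). [folklore] -/
theorem stub_autocorrIntegrableOn :
    ∀ ω₂ lam β γ : ℝ, 0 < ω₂ → 0 < lam → 0 < β → 0 < γ → ∀ T : ℝ, 0 < T → ∀ N : ℕ, let J : Literature.MathematicalPhysics.KineticTheory.HeatConduction.PhaseSpace N → ℝ := fun z => ∑ i : Fin N, (Literature.MathematicalPhysics.KineticTheory.HeatConduction.pinnedChain ω₂ lam β γ).bondCurrent N i z; MeasureTheory.IntegrableOn (fun t : ℝ => ∫ z, J z * (∫ y, J y ∂((Literature.MathematicalPhysics.KineticTheory.HeatConduction.pinnedChain ω₂ lam β γ).transitionKernel N T T t.toNNReal z)) ∂((Literature.MathematicalPhysics.KineticTheory.HeatConduction.pinnedChain ω₂ lam β γ).gibbsMeasure N T)) (Set.Ioi 0) := by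
  intro ω₂ lam β γ hω hl hβ hγ T hT N
  rcases Nat.eq_zero_or_pos N with rfl | hN
  · intro J
    have hJ : J = fun _ => 0 := funext fun z => Finset.sum_of_isEmpty _
    simp only [hJ, zero_mul, integral_zero]
    exact integrableOn_zero
  · exact pinnedChain_integrableOn_totalCurrentAutocorr hω hl.le hβ hγ hN hT

end Summit.AtomisticToContinuum.FouriersLaw.Theorems.AbelThermodynamicLimit.SeriesLawAtEveryLaplaceFrequency
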